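import Literature.MathematicalPhysics.QuantumLattice.XXZAntiferromagnetThermalSpontaneousOrder
import Literature.MathematicalPhysics.QuantumLattice.KomaPiFluxLROGroundState
import Literature.MathematicalPhysics.QuantumLattice.KomaTasakiSU2FieldBound
import HarnessLib

/-!
# The XXZ / Heisenberg antiferromagnet and hard-core bosons on the torus as Koma–Tasaki `U(1)` systems
# with `SU(2)` data — the GROUND-STATE setting of KT93 §7 / KT94 §2.3 (hypotheses (2.12)–(2.17), i)–v))

T. Koma, H. Tasaki, *Symmetry breaking in Heisenberg antiferromagnets*, Commun. Math. Phys. **158** (1993)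
191–214 (`KomaTasaki1993`, held `paper:doi-10-1007-bf02097237`), §7 "Symmetry breaking in ground states",
p. 209 and p. 211:

> Let `Φ_Λ` and `Φ_Λ(B)` be ground states of the Hamiltonians (2.2) and (2.6), respectively. …
> **Theorem 7.3.** Assume that the conditions for Theorem 7.1 are valid, and we further have the `U(1)`
> invariance as discussed above. Also assume that `σ` defined in (7.1) is nonvanishing. Then
> `liminf_{B↓0} liminf_{Λ↑ℤ^d} N⁻¹ (Φ_Λ(B), O^{(1)}_Λ Φ_Λ(B)) ≥ √2 σ`.                                  (7.11)
> **Corollary 7.2.** … and we further have the `SU(2)` invariance as in the above i'') and the assumptions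
> iv) and v) in Sect. 2. Then `liminf_{B↓0} liminf_{Λ↑ℤ^d} N⁻¹ (Φ_Λ(B), O^{(1)}_Λ Φ_Λ(B)) ≥ √3 σ`.        (7.3)

and T. Koma, H. Tasaki, J. Stat. Phys. **76** (1994) 745–803 (`KomaTasaki1994`), §2.3 (the abstract `U(1)`
setting (2.12)–(2.17), i)–iv)) and §3.1 ("Heisenberg antiferromagnets": `h_x` the halved bonds out of `x`,
`o^{(α)}_x = (-1)^x S^{(α)}_x`, `C_Λ = S^{(3)}_tot`).

Both printed theorems are PROVED in the tree for ABSTRACT Koma–Tasaki systems (`KomaTasaki.komaTasakiU1Field_u1`,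
`KomaTasaki.komaTasakiSU2Field`, files `KomaTasakiU1FieldBound.lean`, `KomaTasakiSU2FieldBound.lean`), over the
structures `KomaTasaki.U1System` / `KomaTasaki.SU2Datum` / `KomaTasaki.IsLROEigenstate` (inner-product-space
vocabulary, `KomaTasakiSSB.lean`, `KomaTasakiSSBOrderParameter.lean`).  The only instances so far are Koma's
`π`-flux lattice-fermion model (`KomaPiFlux.ktSystem`) and the `d`-wave overlap system; KT93's OWN models — quantum
spin systems — had none at `T = 0` (the `T > 0` structures `XXZKT.z2System`, `XXZKT.afZ2System`, `XXZKT.afSU2System`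
of `XXZThermalSpontaneousOrder.lean` / `XXZAntiferromagnetThermalSpontaneousOrder.lean` are the matrix-level
KT93 §2 systems for the Gibbs state).  This file supplies them:

* `XXZKT.ktDensity n σ α x = (-1)^{σ x} S^α_x` (`α ∈ {1,2}` as `Fin 2`, embedded in `Fin 3` by `Fin.castSucc`),
  `sum_ktDensity` (`Σ_x = stagSpin n σ α`); the sign exponent `σ : Λ → ℕ` is the sublattice parity
  `torusParityExp` for the ANTIFERROMAGNET (staggered order `O^{(1)} = Σ_x(-1)^xSˣ_x`, KT93 (1.2)) and `σ = 0` for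
  HARD-CORE BOSONS / the planar ferromagnet (plain order `O^{(1)} = Sˣ_tot`; `stagSpin_zero_eq_totalSpin`).
* **`XXZKT.u1System d L n J Δ σ : KomaTasaki.U1System (TorusSite d L) (SpinSpace (TorusSite d L) (n+1))`** —
  the XXZ model `xxzHamiltonian n (torusGraph d L) J Δ` (spin `n/2`) on the torus `(ℤ/Lℤ)^d` in KT94's §2.3
  vocabulary: `h_x = localHam` (halved bonds out of `x`), `o^{(1)}_x = (-1)^{σx}Sˣ_x`, `o^{(2)}_x = (-1)^{σx}Sʸ_x`,
  `C_Λ = Sᶻ_tot`, `S_x = nbhd x` (`r = 2d+2`), `h̄ = XXZKT.hbar`, `ō = sNorm n = n/2+1`, all transported to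
  operators on `ℓ²` by `Matrix.toEuclideanCLM`; EVERY hypothesis (2.12)–(2.16), i)–iii) PROVED
  (`[H, Sᶻ_tot] = 0`: `HardCoreBoson.commute_xxzHamiltonian_totalSpin_two`; (2.14): `totalSpin_two_comm_stagSpin_zero/one`;
  locality: `commute_localHam_stagSign_smul_siteSpin`).
* **`XXZKT.su2Datum d L n J Δ σ : KomaTasaki.SU2Datum (u1System d L n J Δ σ)`** — KT93 §2 iv), v) (2.16):
  `o^{(3)}_x = (-1)^{σx}Sᶻ_x`, `X^{(1)} = Sˣ_tot`, `X^{(2)} = Sʸ_tot` (`X^{(3)} = C_Λ = Sᶻ_tot`), the vector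
  relations `[X^{(j)}, O^{(k)}] = iΣ_l ε_{jkl} O^{(l)}` = tree `totalSpin_comm_stagSpin` (any `Δ`: the structure
  records no Hamiltonian condition; the `SU(2)` invariance of the GROUND STATE, KT93 i''), is supplied where it
  holds — `Δ = 1`, Lieb–Mattis — by the consumer file `XXZGroundStateSpontaneousOrder.lean`).
* Dictionary: `u1System_hamiltonian/order_zero/order_one/C/field/obar/hbar/r`, `su2Datum_J(_zero/_one)`,
  `su2Datum_J_apply_eq_zero` (KT93 i'') from `Sˣ_totΦ = Sʸ_totΦ = 0`).
* **`XXZKT.u1System_isLROEigenstate`** — KT94 hypothesis iv) (2.17) from matrix data: a unit vector `Φ` with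
  `HΦ = E₀Φ`, `Sᶻ_totΦ = νΦ` and `(μ ō N)² ≤ Re Φ†(O^{(1)})²Φ`, `0 < μ`, is an `IsLROEigenstate` of `u1System`
  (the equality `⟨(O^{(1)})²⟩ = ⟨(O^{(2)})²⟩` is the tree's charge bookkeeping
  `KomaTasaki.U1System.inner_order_sq_eq_of_eigen_C`; **`μ ≤ 1` is DERIVED** from `‖O^{(1)}‖ ≤ ōN`,
  `KomaTasaki.U1System.mu_le_one_of_lro`).

No named facts, no sorry; definitions with bodies and proved API only.  Consumers: the `T = 0` symmetry-breaking
theorems for KT93's own models (`XXZGroundStateSpontaneousOrder.lean`).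

## References
* [KomaTasaki1993] T. Koma, H. Tasaki, Commun. Math. Phys. **158** (1993) 191–214, §1 (1.1)–(1.2), §2 (2.14)–(2.17)
  i)–vi) (p. 197), §7 Theorems 7.1, 7.3, Corollary 7.2 (pp. 209–211).
* [KomaTasaki1994] T. Koma, H. Tasaki, J. Stat. Phys. **76** (1994) 745–803, §2.3 (2.12)–(2.17), §3.1.
* [Tasaki2019Tower] H. Tasaki, J. Stat. Phys. **174** (2019) 735–761, §3.2 (the antiferromagnet as the example).
* [Tasaki2020] H. Tasaki, *Physics and Mathematics of Quantum Many-Body Systems*, Springer 2020, §2.1–§2.5, App. A.2.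
-/

noncomputable section

open Matrix Finset Filter Topology WithLp
open scoped ComplexOrder Matrix.Norms.L2Operator InnerProductSpace ComplexConjugate
open Literature.MathematicalPhysics.QuantumLattice Literature.MathematicalPhysics.QuantumLattice.SpinOperators
  Literature.MathematicalPhysics.QuantumLattice.KomaTasaki Literature.Probability.LatticeModels

namespace Literature.MathematicalPhysics.QuantumLattice

/-! ### An abstract complement: `μ ≤ 1` is forced by the long-range-order inequality -/

namespace KomaTasaki.U1System

variable {Λ : Type*} [Fintype Λ] {E : Type*} [NormedAddCommGroup E] [InnerProductSpace ℂ E]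
  (sys : KomaTasaki.U1System Λ E)

/-- `Re⟨Φ, (O^{(α)})²Φ⟩ = ‖O^{(α)}Φ‖² ≤ (ō N)² ‖Φ‖²` (`O^{(α)}` symmetric, `‖O^{(α)}‖ ≤ ōN`).
[cite: KomaTasaki1994, §2.3 iii), (2.13)] -/
theorem re_inner_order_sq_le (α : Fin 2) (Φ : E) :
    (⟪Φ, sys.order α (sys.order α Φ)⟫_ℂ).re ≤ (sys.obar * Fintype.card Λ) ^ 2 * ‖Φ‖ ^ 2 := by
  have h1 : ⟪Φ, sys.order α (sys.order α Φ)⟫_ℂ = ⟪sys.order α Φ, sys.order α Φ⟫_ℂ :=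
    (sys.isSymmetric_order α Φ (sys.order α Φ)).symm
  have h4 : (⟪sys.order α Φ, sys.order α Φ⟫_ℂ).re = ‖sys.order α Φ‖ ^ 2 := by
    rw [inner_self_eq_norm_sq_to_K]; norm_cast
  rw [h1, h4]
  have h2 : ‖sys.order α Φ‖ ≤ sys.obar * Fintype.card Λ * ‖Φ‖ :=
    (ContinuousLinearMap.le_opNorm _ _).trans (mul_le_mul_of_nonneg_right (sys.norm_order_le α) (norm_nonneg _))
  have h3 : (‖sys.order α Φ‖ : ℝ) ^ 2 ≤ (sys.obar * Fintype.card Λ * ‖Φ‖) ^ 2 :=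
    pow_le_pow_left₀ (norm_nonneg _) h2 2
  calc ‖sys.order α Φ‖ ^ 2 ≤ (sys.obar * Fintype.card Λ * ‖Φ‖) ^ 2 := h3
    _ = (sys.obar * Fintype.card Λ) ^ 2 * ‖Φ‖ ^ 2 := by ring

/-- **`μ ≤ 1` from the long-range-order inequality**: if `(μ ō N)² ≤ Re⟨Φ,(O^{(1)})²Φ⟩` for a unit `Φ` on a
nonempty lattice, then `μ ≤ 1` (since the right side is at most `(ōN)²`).  KT94 state `0 < μ ≤ 1` in iv); only
`0 < μ` is a genuine hypothesis. [cite: KomaTasaki1994, §2.3 iv) (2.17)] -/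
theorem mu_le_one_of_lro [Nonempty Λ] {Φ : E} (hΦ : ‖Φ‖ = 1) {μ : ℝ}
    (hlro : (μ * sys.obar * Fintype.card Λ) ^ 2 ≤ (⟪Φ, sys.order 0 (sys.order 0 Φ)⟫_ℂ).re) : μ ≤ 1 := by
  have h := hlro.trans (sys.re_inner_order_sq_le 0 Φ)
  rw [hΦ, one_pow, mul_one] at h
  have hN : (0 : ℝ) < Fintype.card Λ := Nat.cast_pos.mpr Fintype.card_pos
  have hoN : 0 < sys.obar * Fintype.card Λ := mul_pos sys.obar_pos hN
  by_contra hμ1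
  rw [not_le] at hμ1
  have h1 : sys.obar * Fintype.card Λ < μ * sys.obar * Fintype.card Λ := by
    have := mul_lt_mul_of_pos_right hμ1 hoN
    rw [one_mul, ← mul_assoc] at this
    exact this
  have h2 : (sys.obar * Fintype.card Λ) * (sys.obar * Fintype.card Λ) <
      (μ * sys.obar * Fintype.card Λ) * (μ * sys.obar * Fintype.card Λ) := mul_lt_mul'' h1 h1 hoN.le hoN.le
  rw [pow_two, pow_two] at h
  linarith

end KomaTasaki.U1System

/-! ### §1. Generic graph: the order densities `(-1)^{σx}S^α_x` and their commutators -/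

namespace XXZKT

section Graph

variable {Λ : Type*} [Fintype Λ] [DecidableEq Λ] (n : ℕ) (σ : Λ → ℕ)

/-- The Levi-Civita table (values of `KomaTasaki.leviCivita` on `Fin 3`). [cite: KomaTasaki1993, after (2.15)] -/
private theorem lc_table₀ :
    leviCivita 0 1 2 = 1 ∧ leviCivita 1 2 0 = 1 ∧ leviCivita 2 0 1 = 1 ∧
    leviCivita 1 0 2 = -1 ∧ leviCivita 2 1 0 = -1 ∧ leviCivita 0 2 1 = -1 ∧
    leviCivita 0 1 0 = 0 ∧ leviCivita 0 1 1 = 0 ∧ leviCivita 1 2 1 = 0 ∧ leviCivita 1 2 2 = 0 ∧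
    leviCivita 2 0 2 = 0 ∧ leviCivita 2 0 0 = 0 ∧ leviCivita 1 0 1 = 0 ∧ leviCivita 1 0 0 = 0 ∧
    leviCivita 2 1 2 = 0 ∧ leviCivita 2 1 1 = 0 ∧ leviCivita 0 2 0 = 0 ∧ leviCivita 0 2 2 = 0 ∧
    leviCivita 0 0 0 = 0 ∧ leviCivita 0 0 1 = 0 ∧ leviCivita 0 0 2 = 0 ∧
    leviCivita 1 1 0 = 0 ∧ leviCivita 1 1 1 = 0 ∧ leviCivita 1 1 2 = 0 ∧
    leviCivita 2 2 0 = 0 ∧ leviCivita 2 2 1 = 0 ∧ leviCivita 2 2 2 = 0 := by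
  decide

/-- **KT94's order-operator densities for quantum spins**: `o^{(α)}_x = (-1)^{σ x} S^α_x`, `α ∈ {1, 2}`
(here `Fin 2`, embedded in the three components by `Fin.castSucc`): the staggered spin densities of the
antiferromagnet (`σ` = sublattice parity, KT93 (1.2), KT94 §3.1) or the plain spin densities (`σ = 0`,
hard-core bosons / planar ferromagnet). [cite: KomaTasaki1994, §2.3 (2.13), §3.1] [cite: KomaTasaki1993, §1 (1.2), §2 (2.14)] -/
def ktDensity (α : Fin 2) (x : Λ) : Op Λ (n + 1) := (stagSign σ x : ℂ) • siteSpin n x (Fin.castSucc α)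

/-- `o^{(1)}_x = (-1)^{σx} Sˣ_x`. [cite: KomaTasaki1994, §3.1] -/
theorem ktDensity_zero (x : Λ) : ktDensity n σ 0 x = (stagSign σ x : ℂ) • siteSpin n x 0 := rfl

/-- `o^{(2)}_x = (-1)^{σx} Sʸ_x`. [cite: KomaTasaki1994, §3.1] -/
theorem ktDensity_one (x : Λ) : ktDensity n σ 1 x = (stagSign σ x : ℂ) • siteSpin n x 1 := rfl

/-- `Σ_x o^{(α)}_x = O^{(α)} = stagSpin n σ α` (KT94 (2.13)). [cite: KomaTasaki1994, §2.3 (2.13)] -/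
theorem sum_ktDensity (α : Fin 2) : ∑ x, ktDensity n σ α x = stagSpin n σ (Fin.castSucc α) := rfl

/-- `Σ_x o^{(1)}_x = Σ_x(-1)^{σx}Sˣ_x`. [cite: KomaTasaki1993, §1 (1.2)] -/
theorem sum_ktDensity_zero : ∑ x, ktDensity n σ 0 x = stagSpin n σ 0 := rfl

/-- `Σ_x o^{(2)}_x = Σ_x(-1)^{σx}Sʸ_x`. [cite: KomaTasaki1993, §2 (2.14)] -/
theorem sum_ktDensity_one : ∑ x, ktDensity n σ 1 x = stagSpin n σ 1 := rfl

/-- `o^{(α)}_x` is Hermitian. [cite: KomaTasaki1994, §2.1] -/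
theorem isHermitian_ktDensity (α : Fin 2) (x : Λ) : (ktDensity n σ α x).IsHermitian :=
  isHermitian_stagSign_smul_siteSpin n σ x _

/-- `‖o^{(α)}_x‖ ≤ ō = sNorm n`. [cite: KomaTasaki1994, §2.3 iii)] -/
theorem norm_ktDensity_le (α : Fin 2) (x : Λ) : ‖ktDensity n σ α x‖ ≤ sNorm n :=
  norm_stagSign_smul_siteSpin_le n σ x _

/-- With the zero exponent the "staggered" spin is the TOTAL spin: `Σ_x(-1)^0 S^α_x = S^α_tot` (the plain order
parameter of hard-core bosons / the planar ferromagnet). [cite: KomaTasaki1993, §7 (U(1) case: "electron pair condensation")] [cite: Tasaki2020, §2.2 eq. (2.2.11)] -/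
theorem stagSpin_zero_eq_totalSpin (α : Fin 3) :
    stagSpin n (fun _ : Λ => 0) α = (totalSpin n α : Op Λ (n + 1)) := by
  rw [stagSpin, totalSpin]
  refine Finset.sum_congr rfl fun x _ => ?_
  rw [stagSign, pow_zero, Complex.ofReal_one, one_smul]

/-! #### The `U(1)` relations (2.14) and the `SU(2)` vector relations (2.16), spelled out for the components -/

/-- (2.14), first: `O^{(1)}C - CO^{(1)} = -iO^{(2)}` with `C = Sᶻ_tot`. [cite: KomaTasaki1994, §2.3 (2.14)] -/
theorem stagSpin_zero_comm_totalSpin_two :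
    (stagSpin n σ 0 * totalSpin n 2 - totalSpin n 2 * stagSpin n σ 0 : Op Λ (n + 1)) =
      -(Complex.I • stagSpin n σ 1) := by
  rw [← neg_sub, totalSpin_two_comm_stagSpin_zero, neg_neg, neg_smul]

/-- (2.14), second: `O^{(2)}C - CO^{(2)} = iO^{(1)}`. [cite: KomaTasaki1994, §2.3 (2.14)] -/
theorem stagSpin_one_comm_totalSpin_two :
    (stagSpin n σ 1 * totalSpin n 2 - totalSpin n 2 * stagSpin n σ 1 : Op Λ (n + 1)) =
      Complex.I • stagSpin n σ 0 := by
  rw [← neg_sub, totalSpin_two_comm_stagSpin_one, neg_smul, neg_neg]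

/-- v) `j = k`: `[S^j_tot, O^{(j)}] = 0`. [cite: KomaTasaki1993, (2.16)] -/
theorem commute_totalSpin_stagSpin_same (j : Fin 3) :
    Commute (totalSpin n j : Op Λ (n + 1)) (stagSpin n σ j) := by
  have h := totalSpin_comm_stagSpin n σ j j
  have h0 : ∑ l, (leviCivita j j l : ℂ) • (stagSpin n σ l : Op Λ (n + 1)) = 0 :=
    Finset.sum_eq_zero fun l _ => by rw [leviCivita_values.2.2.2.2.2.2 j l, Int.cast_zero, zero_smul]
  rw [h0, smul_zero, sub_eq_zero] at h
  exact h

/-- v): `Sˣ_tot O^{(2)} - O^{(2)} Sˣ_tot = i O^{(3)}`. [cite: KomaTasaki1993, (2.16)] -/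
theorem totalSpin_zero_comm_stagSpin_one :
    (totalSpin n 0 * stagSpin n σ 1 - stagSpin n σ 1 * totalSpin n 0 : Op Λ (n + 1)) =
      Complex.I • stagSpin n σ 2 := by
  obtain ⟨e012, -, -, -, -, -, e010, e011, -⟩ := lc_table₀
  rw [totalSpin_comm_stagSpin]
  simp only [Fin.sum_univ_three, e010, e011, e012, Int.cast_zero, Int.cast_one, zero_smul, one_smul, zero_add]

/-- v): `Sˣ_tot O^{(3)} - O^{(3)} Sˣ_tot = -i O^{(2)}`. [cite: KomaTasaki1993, (2.16)] -/
theorem totalSpin_zero_comm_stagSpin_two :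
    (totalSpin n 0 * stagSpin n σ 2 - stagSpin n σ 2 * totalSpin n 0 : Op Λ (n + 1)) =
      -(Complex.I • stagSpin n σ 1) := by
  obtain ⟨-, -, -, -, -, e021, -, -, -, -, -, -, -, -, -, -, e020, e022, -⟩ := lc_table₀
  rw [totalSpin_comm_stagSpin]
  simp only [Fin.sum_univ_three, e020, e021, e022, Int.cast_zero, Int.cast_one, Int.cast_neg, zero_smul,
    neg_smul, one_smul, zero_add, add_zero, smul_neg]

/-- v): `Sʸ_tot O^{(1)} - O^{(1)} Sʸ_tot = -i O^{(3)}`. [cite: KomaTasaki1993, (2.16)] -/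
theorem totalSpin_one_comm_stagSpin_zero :
    (totalSpin n 1 * stagSpin n σ 0 - stagSpin n σ 0 * totalSpin n 1 : Op Λ (n + 1)) =
      -(Complex.I • stagSpin n σ 2) := by
  obtain ⟨-, -, -, e102, -, -, -, -, -, -, -, -, e101, e100, -⟩ := lc_table₀
  rw [totalSpin_comm_stagSpin]
  simp only [Fin.sum_univ_three, e100, e101, e102, Int.cast_zero, Int.cast_one, Int.cast_neg, zero_smul,
    neg_smul, one_smul, zero_add, smul_neg]

/-- v): `Sʸ_tot O^{(3)} - O^{(3)} Sʸ_tot = i O^{(1)}`. [cite: KomaTasaki1993, (2.16)] -/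
theorem totalSpin_one_comm_stagSpin_two :
    (totalSpin n 1 * stagSpin n σ 2 - stagSpin n σ 2 * totalSpin n 1 : Op Λ (n + 1)) =
      Complex.I • stagSpin n σ 0 := by
  obtain ⟨-, e120, -, -, -, -, -, -, e121, e122, -⟩ := lc_table₀
  rw [totalSpin_comm_stagSpin]
  simp only [Fin.sum_univ_three, e120, e121, e122, Int.cast_zero, Int.cast_one, zero_smul, one_smul, add_zero]

end Graph

/-! ### §2. The torus `(ℤ/Lℤ)^d`: the ground-state Koma–Tasaki `U(1)` system and its `SU(2)` datum -/

section Torus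

variable (d L n : ℕ) [NeZero L]

/-- `y ∉ nbhd x ⟹ y ≠ x ∧ ¬ x ∼ y`. [cite: KomaTasaki1993, §2 iii)] -/
theorem ne_and_not_adj_of_not_mem_nbhd {x y : TorusSite d L} (hy : y ∉ nbhd d L x) :
    y ≠ x ∧ ¬ (torusGraph d L).Adj x y :=
  ⟨fun h => hy (h ▸ Finset.mem_insert_self _ _),
    fun h => hy (Finset.mem_insert_of_mem (Finset.mem_filter.2 ⟨Finset.mem_univ _, h⟩))⟩

/-- **THE XXZ MODEL ON THE TORUS AS A KOMA–TASAKI `U(1)` SYSTEM (ground-state setting, KT94 §2.3 / KT93 §7).**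
Lattice `Λ = (ℤ/Lℤ)^d`, Hilbert space `ℓ²((Λ → Fin (n+1)))` (`SpinSpace`), `h_x = localHam n (torusGraph d L) J Δ x`
(`Σ_x h_x = xxzHamiltonian n (torusGraph d L) J Δ`), `o^{(1)}_x = (-1)^{σx}Sˣ_x`, `o^{(2)}_x = (-1)^{σx}Sʸ_x`,
`C_Λ = Sᶻ_tot`, `S_x = nbhd x`, `r = 2d+2`, `h̄ = hbar d n J Δ`, `ō = sNorm n`; hypotheses (2.12) `[H,C] = 0`,
(2.14), i) `[o_x, o_y] = 0` (`x ≠ y`), ii) locality and `|S_x| ≤ r`, iii) norms — all proved.  `σ = torusParityExp d L`: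
the antiferromagnet with STAGGERED order (KT93 (1.2)); `σ = 0`: PLAIN order (`O^{(1)} = Sˣ_tot`).
[cite: KomaTasaki1994, §2.3 (2.12)–(2.16) i)–iii), §3.1] [cite: KomaTasaki1993, §2 ii)–v), §7] -/
def u1System (J Δ : ℝ) (σ : TorusSite d L → ℕ) :
    KomaTasaki.U1System (TorusSite d L) (SpinSpace (TorusSite d L) (n + 1)) where
  h x := toEuclideanCLM (n := TensorIndex (TorusSite d L) (n + 1)) (𝕜 := ℂ) (localHam n (torusGraph d L) J Δ x)
  o α x := toEuclideanCLM (n := TensorIndex (TorusSite d L) (n + 1)) (𝕜 := ℂ) (ktDensity n σ α x)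
  C := toEuclideanCLM (n := TensorIndex (TorusSite d L) (n + 1)) (𝕜 := ℂ) (totalSpin n 2)
  supp := nbhd d L
  r := 2 * d + 2
  hbar := hbar d n J Δ
  obar := sNorm n
  isSymmetric_h x := isSymmetric_toEuclideanCLM_of_isHermitian (isHermitian_localHam n _ J Δ x)
  isSymmetric_o α x := isSymmetric_toEuclideanCLM_of_isHermitian (isHermitian_ktDensity n σ α x)
  isSymmetric_C := isSymmetric_toEuclideanCLM_of_isHermitian (totalSpin_isHermitian n 2)
  commute_hamiltonian_C := by
    rw [← map_sum, sum_localHam]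
    exact commute_toEuclideanCLM_of_commute (HardCoreBoson.commute_xxzHamiltonian_totalSpin_two n _ J Δ)
  order_zero_C := by
    rw [← map_sum, ← map_sum, ← map_mul, ← map_mul, ← map_sub, sum_ktDensity_zero, sum_ktDensity_one,
      stagSpin_zero_comm_totalSpin_two, map_neg, map_smul]
  order_one_C := by
    rw [← map_sum, ← map_sum, ← map_mul, ← map_mul, ← map_sub, sum_ktDensity_zero, sum_ktDensity_one,
      stagSpin_one_comm_totalSpin_two, map_smul]
  commute_o x y hxy α β := commute_toEuclideanCLM_of_commute (commute_stagSign_smul_siteSpin n σ hxy _ _)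
  commute_h_o x y hy α := by
    obtain ⟨hne, hadj⟩ := ne_and_not_adj_of_not_mem_nbhd d L hy
    exact commute_toEuclideanCLM_of_commute
      (commute_localHam_stagSign_smul_siteSpin n σ (torusGraph d L) J Δ hne hadj _)
  card_supp_le x := (card_nbhd_le d L x).trans (by omega)
  two_le_r := by omega
  norm_h_le x := by rw [Matrix.l2_opNorm_toEuclideanCLM]; exact norm_localHam_le d L n J Δ x
  norm_o_le α x := by rw [Matrix.l2_opNorm_toEuclideanCLM]; exact norm_ktDensity_le n σ α x
  obar_pos := lt_of_lt_of_le zero_lt_one (one_le_sNorm n)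

/-- **THE `SU(2)` DATUM** (KT93 §2 iv), v) for the spin system): third component `o^{(3)}_x = (-1)^{σx}Sᶻ_x`,
generators `X^{(1)} = Sˣ_tot`, `X^{(2)} = Sʸ_tot` (`X^{(3)} = C_Λ = Sᶻ_tot`), with the vector relations (2.16)
`[X^{(j)}, O^{(k)}] = iΣ_l ε_{jkl}O^{(l)}` and iv) `[o^{(i)}_x, o^{(j)}_y] = 0` (`x ≠ y`) — valid for every `Δ`
(the structure records no Hamiltonian condition; the `SU(2)` invariance of the ground state, KT93 i''), is a
separate input). [cite: KomaTasaki1993, §2 (2.14)–(2.16) iv), v); §7 i'')] -/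
def su2Datum (J Δ : ℝ) (σ : TorusSite d L → ℕ) : KomaTasaki.SU2Datum (u1System d L n J Δ σ) where
  o₃ x := toEuclideanCLM (n := TensorIndex (TorusSite d L) (n + 1)) (𝕜 := ℂ) ((stagSign σ x : ℂ) • siteSpin n x 2)
  J a := toEuclideanCLM (n := TensorIndex (TorusSite d L) (n + 1)) (𝕜 := ℂ) (totalSpin n (Fin.castSucc a))
  isSymmetric_o₃ x := isSymmetric_toEuclideanCLM_of_isHermitian (isHermitian_stagSign_smul_siteSpin n σ x 2)
  isSymmetric_J a := isSymmetric_toEuclideanCLM_of_isHermitian (totalSpin_isHermitian n _)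
  norm_o₃_le x := by
    rw [Matrix.l2_opNorm_toEuclideanCLM]
    exact norm_stagSign_smul_siteSpin_le n σ x 2
  commute_o_o₃ x y hxy α := commute_toEuclideanCLM_of_commute (commute_stagSign_smul_siteSpin n σ hxy _ _)
  commute_o₃_o₃ x y hxy := commute_toEuclideanCLM_of_commute (commute_stagSign_smul_siteSpin n σ hxy _ _)
  J0_order0 := by
    rw [KomaTasaki.U1System.order]
    change Commute (toEuclideanCLM (n := TensorIndex (TorusSite d L) (n + 1)) (𝕜 := ℂ) (totalSpin n 0))
      (∑ x, toEuclideanCLM (n := TensorIndex (TorusSite d L) (n + 1)) (𝕜 := ℂ) (ktDensity n σ 0 x))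
    rw [← map_sum, sum_ktDensity_zero]
    exact commute_toEuclideanCLM_of_commute (commute_totalSpin_stagSpin_same n σ 0)
  J0_order1 := by
    rw [KomaTasaki.U1System.order]
    change toEuclideanCLM (n := TensorIndex (TorusSite d L) (n + 1)) (𝕜 := ℂ) (totalSpin n 0) *
        (∑ x, toEuclideanCLM (n := TensorIndex (TorusSite d L) (n + 1)) (𝕜 := ℂ) (ktDensity n σ 1 x)) -
        (∑ x, toEuclideanCLM (n := TensorIndex (TorusSite d L) (n + 1)) (𝕜 := ℂ) (ktDensity n σ 1 x)) *
          toEuclideanCLM (n := TensorIndex (TorusSite d L) (n + 1)) (𝕜 := ℂ) (totalSpin n 0) = _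
    rw [← map_sum, sum_ktDensity_one, ← map_mul, ← map_mul, ← map_sub, totalSpin_zero_comm_stagSpin_one,
      map_smul, ← map_sum]
    rfl
  J0_order3 := by
    rw [KomaTasaki.U1System.order]
    change toEuclideanCLM (n := TensorIndex (TorusSite d L) (n + 1)) (𝕜 := ℂ) (totalSpin n 0) *
        (∑ x, toEuclideanCLM (n := TensorIndex (TorusSite d L) (n + 1)) (𝕜 := ℂ) ((stagSign σ x : ℂ) • siteSpin n x 2)) -
        (∑ x, toEuclideanCLM (n := TensorIndex (TorusSite d L) (n + 1)) (𝕜 := ℂ) ((stagSign σ x : ℂ) • siteSpin n x 2)) *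
          toEuclideanCLM (n := TensorIndex (TorusSite d L) (n + 1)) (𝕜 := ℂ) (totalSpin n 0) =
      -(Complex.I • ∑ x, toEuclideanCLM (n := TensorIndex (TorusSite d L) (n + 1)) (𝕜 := ℂ) (ktDensity n σ 1 x))
    rw [← map_sum, ← map_sum, sum_ktDensity_one, ← map_mul, ← map_mul, ← map_sub]
    change toEuclideanCLM (n := TensorIndex (TorusSite d L) (n + 1)) (𝕜 := ℂ)
        (totalSpin n 0 * stagSpin n σ 2 - stagSpin n σ 2 * totalSpin n 0) = _
    rw [totalSpin_zero_comm_stagSpin_two, map_neg, map_smul]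
  J1_order0 := by
    rw [KomaTasaki.U1System.order]
    change toEuclideanCLM (n := TensorIndex (TorusSite d L) (n + 1)) (𝕜 := ℂ) (totalSpin n 1) *
        (∑ x, toEuclideanCLM (n := TensorIndex (TorusSite d L) (n + 1)) (𝕜 := ℂ) (ktDensity n σ 0 x)) -
        (∑ x, toEuclideanCLM (n := TensorIndex (TorusSite d L) (n + 1)) (𝕜 := ℂ) (ktDensity n σ 0 x)) *
          toEuclideanCLM (n := TensorIndex (TorusSite d L) (n + 1)) (𝕜 := ℂ) (totalSpin n 1) = _
    rw [← map_sum, sum_ktDensity_zero, ← map_mul, ← map_mul, ← map_sub, totalSpin_one_comm_stagSpin_zero,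
      map_neg, map_smul, ← map_sum]
    rfl
  J1_order1 := by
    rw [KomaTasaki.U1System.order]
    change Commute (toEuclideanCLM (n := TensorIndex (TorusSite d L) (n + 1)) (𝕜 := ℂ) (totalSpin n 1))
      (∑ x, toEuclideanCLM (n := TensorIndex (TorusSite d L) (n + 1)) (𝕜 := ℂ) (ktDensity n σ 1 x))
    rw [← map_sum, sum_ktDensity_one]
    exact commute_toEuclideanCLM_of_commute (commute_totalSpin_stagSpin_same n σ 1)
  J1_order3 := by
    rw [KomaTasaki.U1System.order]
    change toEuclideanCLM (n := TensorIndex (TorusSite d L) (n + 1)) (𝕜 := ℂ) (totalSpin n 1) *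
        (∑ x, toEuclideanCLM (n := TensorIndex (TorusSite d L) (n + 1)) (𝕜 := ℂ) ((stagSign σ x : ℂ) • siteSpin n x 2)) -
        (∑ x, toEuclideanCLM (n := TensorIndex (TorusSite d L) (n + 1)) (𝕜 := ℂ) ((stagSign σ x : ℂ) • siteSpin n x 2)) *
          toEuclideanCLM (n := TensorIndex (TorusSite d L) (n + 1)) (𝕜 := ℂ) (totalSpin n 1) =
      Complex.I • ∑ x, toEuclideanCLM (n := TensorIndex (TorusSite d L) (n + 1)) (𝕜 := ℂ) (ktDensity n σ 0 x)
    rw [← map_sum, ← map_sum, sum_ktDensity_zero, ← map_mul, ← map_mul, ← map_sub]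
    change toEuclideanCLM (n := TensorIndex (TorusSite d L) (n + 1)) (𝕜 := ℂ)
        (totalSpin n 1 * stagSpin n σ 2 - stagSpin n σ 2 * totalSpin n 1) = _
    rw [totalSpin_one_comm_stagSpin_two, map_smul]
  order3_C := by
    change Commute (∑ x, toEuclideanCLM (n := TensorIndex (TorusSite d L) (n + 1)) (𝕜 := ℂ)
        ((stagSign σ x : ℂ) • siteSpin n x 2))
      (toEuclideanCLM (n := TensorIndex (TorusSite d L) (n + 1)) (𝕜 := ℂ) (totalSpin n 2))
    rw [← map_sum]
    exact commute_toEuclideanCLM_of_commute (commute_totalSpin_stagSpin_same n σ 2).symm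

/-! #### Dictionary -/

section Dictionary

variable (J Δ : ℝ) (σ : TorusSite d L → ℕ)

/-- `H_sys = toEuclideanCLM (xxzHamiltonian n (torusGraph d L) J Δ)`. [cite: KomaTasaki1994, (2.3), §3.1] -/
theorem u1System_hamiltonian :
    (u1System d L n J Δ σ).hamiltonian =
      toEuclideanCLM (n := TensorIndex (TorusSite d L) (n + 1)) (𝕜 := ℂ) (xxzHamiltonian n (torusGraph d L) J Δ) := by
  change ∑ x, toEuclideanCLM (n := TensorIndex (TorusSite d L) (n + 1)) (𝕜 := ℂ) (localHam n (torusGraph d L) J Δ x) = _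
  rw [← map_sum, sum_localHam]

/-- `O^{(1)}_sys = toEuclideanCLM (Σ_x(-1)^{σx}Sˣ_x)`. [cite: KomaTasaki1994, (2.13)] [cite: KomaTasaki1993, §1 (1.2)] -/
theorem u1System_order_zero :
    (u1System d L n J Δ σ).order 0 =
      toEuclideanCLM (n := TensorIndex (TorusSite d L) (n + 1)) (𝕜 := ℂ) (stagSpin n σ 0) := by
  change ∑ x, toEuclideanCLM (n := TensorIndex (TorusSite d L) (n + 1)) (𝕜 := ℂ) (ktDensity n σ 0 x) = _
  rw [← map_sum, sum_ktDensity_zero]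

/-- `O^{(2)}_sys = toEuclideanCLM (Σ_x(-1)^{σx}Sʸ_x)`. [cite: KomaTasaki1994, (2.13)] -/
theorem u1System_order_one :
    (u1System d L n J Δ σ).order 1 =
      toEuclideanCLM (n := TensorIndex (TorusSite d L) (n + 1)) (𝕜 := ℂ) (stagSpin n σ 1) := by
  change ∑ x, toEuclideanCLM (n := TensorIndex (TorusSite d L) (n + 1)) (𝕜 := ℂ) (ktDensity n σ 1 x) = _
  rw [← map_sum, sum_ktDensity_one]

/-- `C_sys = toEuclideanCLM (Sᶻ_tot)`. [cite: KomaTasaki1994, (2.12), §3.1] -/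
theorem u1System_C :
    (u1System d L n J Δ σ).C = toEuclideanCLM (n := TensorIndex (TorusSite d L) (n + 1)) (𝕜 := ℂ) (totalSpin n 2) :=
  rfl

/-- `ō = sNorm n`. [cite: KomaTasaki1994, §2.3 iii)] -/
theorem u1System_obar : (u1System d L n J Δ σ).obar = sNorm n := rfl

/-- `h̄ = hbar d n J Δ`. [cite: KomaTasaki1994, §2.3 iii)] -/
theorem u1System_hbar : (u1System d L n J Δ σ).hbar = hbar d n J Δ := rfl

/-- `r = 2d+2`. [cite: KomaTasaki1994, §2.3 ii)] -/
theorem u1System_r : (u1System d L n J Δ σ).r = 2 * d + 2 := rfl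

/-- **The sourced Hamiltonian of the instance is KT93's `H_Λ(B) = H_Λ - B O^{(1)}_Λ` (2.6)**:
`H_sys - B·O^{(1)}_sys = toEuclideanCLM (xxzHamiltonian … - B·Σ_x(-1)^{σx}Sˣ_x)`. [cite: KomaTasaki1993, §2 (2.6), §7] -/
theorem u1System_field (B : ℝ) :
    (u1System d L n J Δ σ).hamiltonian - (B : ℂ) • (u1System d L n J Δ σ).order 0 =
      toEuclideanCLM (n := TensorIndex (TorusSite d L) (n + 1)) (𝕜 := ℂ)
        (xxzHamiltonian n (torusGraph d L) J Δ - (B : ℂ) • stagSpin n σ 0) := by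
  rw [u1System_hamiltonian, u1System_order_zero, ← map_smul, ← map_sub]

/-- `X^{(a)} = toEuclideanCLM (S^a_tot)`, `a ∈ {1,2}`. [cite: KomaTasaki1993, §2 (2.15), §1] -/
theorem su2Datum_J (a : Fin 2) :
    (su2Datum d L n J Δ σ).J a =
      toEuclideanCLM (n := TensorIndex (TorusSite d L) (n + 1)) (𝕜 := ℂ) (totalSpin n (Fin.castSucc a)) :=
  rfl

/-- `X^{(1)} = toEuclideanCLM (Sˣ_tot)`. [cite: KomaTasaki1993, §2 (2.15)] -/
theorem su2Datum_J_zero :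
    (su2Datum d L n J Δ σ).J 0 = toEuclideanCLM (n := TensorIndex (TorusSite d L) (n + 1)) (𝕜 := ℂ) (totalSpin n 0) :=
  rfl

/-- `X^{(2)} = toEuclideanCLM (Sʸ_tot)`. [cite: KomaTasaki1993, §2 (2.15)] -/
theorem su2Datum_J_one :
    (su2Datum d L n J Δ σ).J 1 = toEuclideanCLM (n := TensorIndex (TorusSite d L) (n + 1)) (𝕜 := ℂ) (totalSpin n 1) :=
  rfl

/-- **Hypothesis iv) (2.17) from matrix data.**  A unit vector `Φ` of `ℓ²(Λ → Fin (n+1))` which is an eigenvector of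
`H = xxzHamiltonian n (torusGraph d L) J Δ` (eigenvalue `E₀`) and of `Sᶻ_tot` (`Sᶻ_totΦ = νΦ`), with long-range order
`(μ ō N)² ≤ Re Φ†(O^{(1)})²Φ`, `O^{(1)} = Σ_x(-1)^{σx}Sˣ_x`, `0 < μ`, is an `IsLROEigenstate` of `u1System` with
parameter `μ`: `⟨(O^{(1)})²⟩ = ⟨(O^{(2)})²⟩` by charge bookkeeping (`inner_order_sq_eq_of_eigen_C`) and `μ ≤ 1` by
`mu_le_one_of_lro`. [cite: KomaTasaki1994, §2.3 iv) (2.17), §3.1] [cite: KomaTasaki1993, §7 (7.1), i')] -/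
theorem u1System_isLROEigenstate {Φ : TensorIndex (TorusSite d L) (n + 1) → ℂ} {E₀ : ℝ} {ν : ℂ} {μ : ℝ}
    (hΦ : star Φ ⬝ᵥ Φ = 1)
    (hH : xxzHamiltonian n (torusGraph d L) J Δ *ᵥ Φ = (E₀ : ℂ) • Φ)
    (hN : totalSpin n 2 *ᵥ Φ = ν • Φ) (hμ : 0 < μ)
    (hlro : (μ * sNorm n * (Fintype.card (TorusSite d L) : ℝ)) ^ 2 ≤
      (star Φ ⬝ᵥ (stagSpin n σ 0 *ᵥ (stagSpin n σ 0 *ᵥ Φ))).re) :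
    KomaTasaki.IsLROEigenstate (u1System d L n J Δ σ) (toLp 2 Φ) E₀ μ := by
  set sys := u1System d L n J Δ σ with hsys
  have hC : sys.C (toLp 2 Φ) = ν • toLp 2 Φ := by
    rw [hsys, u1System_C, toEuclideanCLM_toLp, hN, toLp_smul]
  have hsq := KomaTasaki.U1System.inner_order_sq_eq_of_eigen_C sys hC
  have h0 : (⟪(toLp 2 Φ : SpinSpace (TorusSite d L) (n + 1)), sys.order 0 (sys.order 0 (toLp 2 Φ))⟫_ℂ).re =
      (star Φ ⬝ᵥ (stagSpin n σ 0 *ᵥ (stagSpin n σ 0 *ᵥ Φ))).re := by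
    rw [hsys, u1System_order_zero, toEuclideanCLM_toLp, toEuclideanCLM_toLp, inner_toLp_toLp_eq_dotProduct]
  have hnorm : ‖(toLp 2 Φ : SpinSpace (TorusSite d L) (n + 1))‖ = 1 := norm_toLp_eq_one_of_dotProduct hΦ
  have hlro' : (μ * sys.obar * Fintype.card (TorusSite d L)) ^ 2 ≤
      (⟪(toLp 2 Φ : SpinSpace (TorusSite d L) (n + 1)), sys.order 0 (sys.order 0 (toLp 2 Φ))⟫_ℂ).re := by
    rw [h0, hsys, u1System_obar]
    exact hlro
  exact
    { norm_eq_one := hnorm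
      eigen_hamiltonian := by rw [hsys, u1System_hamiltonian, toEuclideanCLM_toLp, hH, toLp_smul]
      eigen_C := ⟨_, hC⟩
      mu_pos := hμ
      mu_le_one := KomaTasaki.U1System.mu_le_one_of_lro sys hnorm hlro'
      lro := hlro'
      lro_eq := hsq }

/-- **KT93 i'') from matrix data**: if `Sˣ_totΦ = 0 = Sʸ_totΦ` then `X^{(a)}(toLp Φ) = 0` for the `SU(2)` datum.
[cite: KomaTasaki1993, §7 i'')] -/
theorem su2Datum_J_apply_eq_zero {Φ : TensorIndex (TorusSite d L) (n + 1) → ℂ}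
    (h0 : totalSpin n 0 *ᵥ Φ = 0) (h1 : totalSpin n 1 *ᵥ Φ = 0) (a : Fin 2) :
    (su2Datum d L n J Δ σ).J a (toLp 2 Φ) = 0 := by
  fin_cases a
  · change toEuclideanCLM (n := TensorIndex (TorusSite d L) (n + 1)) (𝕜 := ℂ) (totalSpin n 0) (toLp 2 Φ) = 0
    rw [toEuclideanCLM_toLp, h0, toLp_zero]
  · change toEuclideanCLM (n := TensorIndex (TorusSite d L) (n + 1)) (𝕜 := ℂ) (totalSpin n 1) (toLp 2 Φ) = 0
    rw [toEuclideanCLM_toLp, h1, toLp_zero]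

end Dictionary

end Torus

end XXZKT

end Literature.MathematicalPhysics.QuantumLattice
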